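import Mathlib
import Literature.Analysis.FluidPDE.VectorCalculus

/-!
# The `e`-uniform tail bound for the self-induction integral of a chord-arc filament

Tools stub `stub_selfInductionTail` of line `Sketch` (crux `SkeletonEquilibrium`, thesis
`FilamentSkeletonRss`). The self-induced velocity of a vortex filament `X : ℝ → ℝ³` at its own
point `X t`, for the Rosenhead-regularised Biot–Savart kernel `K_e(z) = (‖z‖² + e²)^{-3/2}`, is
`∫ K_e(X t − X u) • X′(u) × (X t − X u) du`; the local-induction asymptotics split it into the
window `|u − t| ≤ δ` (where the `log (1/e)` lives) and the tail `|u − t| ≥ δ`. This file bounds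
the TAIL uniformly in `e`: if `X` is `C¹` with `‖X′‖ ≤ 1` and chord-arc from `t`,
`c |u − t| ≤ ‖X u − X t‖` with `c > 0`, then the tail integrand is integrable on
`{u | δ ≤ |u − t|}` and its integral has norm at most `2 / (c² δ)`.

Proof: with `z = X t − X u`, `r = ‖z‖ ≥ c |u − t| ≥ c δ > 0` on the tail, the integrand has norm
at most `r / (r² + e²)^{3/2} ≤ r / r³ = r⁻² ≤ c⁻² (u − t)⁻²`; the majorant `c⁻² (u − t)⁻²` is
integrable on the tail with integral exactly `2 / (c² δ)` (translate by `t`, split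
`{v | δ ≤ |v|} = Iic (−δ) ∪ Ici δ`, reflect the left half, and use `∫_{Ioi δ} v⁻² = δ⁻¹`).
Integrability of the vector integrand follows from its continuity (`e ≠ 0`) and the majorant.
-/

noncomputable section

open MeasureTheory Filter Topology Set
open Literature.Analysis.FluidPDE

namespace Summit.NavierStokesRegularity.NavierStokesRegularity.Theorems.SkeletonEquilibrium.Sketch
set_option linter.dupNamespace false

/-- `‖v × w‖ ≤ ‖v‖ ‖w‖` (from `norm_cross`, `sin ≤ 1`). [folklore] -/
private theorem sit_norm_cross_le (v w : EuclideanSpace ℝ (Fin 3)) :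
    ‖cross v w‖ ≤ ‖v‖ * ‖w‖ := by
  -- adapted from FilamentSkeletonRssSkeletonEquilibriumBiotSavartFarField (bsff_norm_cross_le)
  rw [norm_cross]
  exact mul_le_of_le_one_right (by positivity) (Real.sin_le_one _)

/-- `b ^ (3/2) = b √b` for `0 < b`. [folklore] -/
private theorem sit_rpow_three_halves {b : ℝ} (hb : 0 < b) :
    b ^ (3 / 2 : ℝ) = b * Real.sqrt b := by
  -- adapted from FilamentSkeletonRssSkeletonEquilibriumBiotSavartFarField (bsff_rpow_three_halves)
  rw [show (3 / 2 : ℝ) = 1 + 1 / 2 by norm_num, Real.rpow_add hb, Real.rpow_one, Real.sqrt_eq_rpow]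

/-- The `e`-uniform scalar kernel bound `r / (r² + e²)^{3/2} ≤ (r²)⁻¹` for `0 < r`
(since `r² ≤ r² + e²` and `r ≤ √(r² + e²)`). [folklore] -/
private theorem sit_kernel_mul_le_inv_sq {r : ℝ} (hr : 0 < r) (e : ℝ) :
    ((r ^ 2 + e ^ 2) ^ (3 / 2 : ℝ))⁻¹ * r ≤ (r ^ 2)⁻¹ := by
  -- adapted from FilamentSkeletonRssSkeletonEquilibriumBiotSavartFarField
  -- (bsff_kernel_mul_le_inv_sq)
  have hb : 0 < r ^ 2 + e ^ 2 := by positivity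
  have hs : 0 < Real.sqrt (r ^ 2 + e ^ 2) := Real.sqrt_pos.2 hb
  have h1 : r ^ 2 ≤ r ^ 2 + e ^ 2 := by nlinarith [sq_nonneg e]
  have h2 : r ≤ Real.sqrt (r ^ 2 + e ^ 2) := Real.le_sqrt_of_sq_le h1
  rw [sit_rpow_three_halves hb, inv_mul_le_iff₀ (mul_pos hb hs), le_mul_inv_iff₀ (pow_pos hr 2)]
  calc r * r ^ 2 = r ^ 2 * r := mul_comm _ _
    _ ≤ (r ^ 2 + e ^ 2) * Real.sqrt (r ^ 2 + e ^ 2) := mul_le_mul h1 h2 hr.le hb.le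

/-- `∫_{(δ, ∞)} v⁻² dv = δ⁻¹` for `0 < δ` (`integral_Ioi_rpow_of_lt` with exponent `−2`).
[folklore] -/
private theorem sit_integral_inv_sq_Ioi {δ : ℝ} (hδ : 0 < δ) :
    ∫ v in Ioi δ, (v ^ 2)⁻¹ = δ⁻¹ := by
  calc ∫ v in Ioi δ, (v ^ 2)⁻¹ = ∫ v in Ioi δ, v ^ (-2 : ℝ) := by
        refine setIntegral_congr_fun measurableSet_Ioi fun v hv => ?_
        have hv0 : 0 ≤ v := (hδ.trans hv).le
        rw [Real.rpow_neg hv0, Real.rpow_two]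
    _ = δ⁻¹ := by
        rw [integral_Ioi_rpow_of_lt (by norm_num) hδ, show (-2 : ℝ) + 1 = -1 by norm_num,
          Real.rpow_neg_one]
        ring

/-- `∫_{(−∞, −δ]} v⁻² dv = δ⁻¹` for `0 < δ` (reflection of `sit_integral_inv_sq_Ioi`).
[folklore] -/
private theorem sit_integral_inv_sq_Iic {δ : ℝ} (hδ : 0 < δ) :
    ∫ v in Iic (-δ), (v ^ 2)⁻¹ = δ⁻¹ := by
  have h := integral_comp_neg_Iic (-δ) (fun v : ℝ => (v ^ 2)⁻¹)
  simp only [neg_sq, neg_neg] at h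
  rw [h]
  exact sit_integral_inv_sq_Ioi hδ

/-- The symmetric tail `{v | δ ≤ |v|}` is `Iic (−δ) ∪ Ici δ`. [folklore] -/
private theorem sit_tail_eq_union (δ : ℝ) :
    {v : ℝ | δ ≤ |v|} = Iic (-δ) ∪ Ici δ := by
  ext v
  simp only [mem_setOf_eq, mem_union, mem_Iic, mem_Ici, le_abs']

/-- For `0 < δ`, `v ↦ v⁻²` is integrable on the tail `{v | δ ≤ |v|}` with integral `2 δ⁻¹`
(integrability of each half follows from its nonzero integral `δ⁻¹`). [folklore] -/
private theorem sit_inv_sq_tail {δ : ℝ} (hδ : 0 < δ) :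
    IntegrableOn (fun v : ℝ => (v ^ 2)⁻¹) {v : ℝ | δ ≤ |v|} ∧
      ∫ v in {v : ℝ | δ ≤ |v|}, (v ^ 2)⁻¹ = 2 * δ⁻¹ := by
  have hIci : ∫ v in Ici δ, (v ^ 2)⁻¹ = δ⁻¹ := by
    rw [integral_Ici_eq_integral_Ioi]
    exact sit_integral_inv_sq_Ioi hδ
  have hne : (δ⁻¹ : ℝ) ≠ 0 := (inv_pos.2 hδ).ne'
  have hint1 : IntegrableOn (fun v : ℝ => (v ^ 2)⁻¹) (Iic (-δ)) :=
    Integrable.of_integral_ne_zero (by rw [sit_integral_inv_sq_Iic hδ]; exact hne)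
  have hint2 : IntegrableOn (fun v : ℝ => (v ^ 2)⁻¹) (Ici δ) :=
    Integrable.of_integral_ne_zero (by rw [hIci]; exact hne)
  have hdisj : Disjoint (Iic (-δ)) (Ici δ) :=
    Set.disjoint_left.2 fun v hv1 hv2 => by
      simp only [mem_Iic, mem_Ici] at hv1 hv2
      linarith
  rw [sit_tail_eq_union]
  refine ⟨hint1.union hint2, ?_⟩
  rw [setIntegral_union hdisj measurableSet_Ici hint1 hint2, sit_integral_inv_sq_Iic hδ, hIci]
  ring

/-- The translated and scaled majorant: for `0 < δ`, `u ↦ (c²)⁻¹ ((u − t)²)⁻¹` is integrable on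
`{u | δ ≤ |u − t|}` with integral `2 / (c² δ)` (translation invariance of Lebesgue measure).
[folklore] -/
private theorem sit_majorant_tail (c t : ℝ) {δ : ℝ} (hδ : 0 < δ) :
    IntegrableOn (fun u : ℝ => (c ^ 2)⁻¹ * ((u - t) ^ 2)⁻¹) {u : ℝ | δ ≤ |u - t|} ∧
      ∫ u in {u : ℝ | δ ≤ |u - t|}, (c ^ 2)⁻¹ * ((u - t) ^ 2)⁻¹ = 2 / (c ^ 2 * δ) := by
  obtain ⟨hint, hval⟩ := sit_inv_sq_tail hδ
  have hmp : MeasurePreserving (fun u : ℝ => u - t) volume volume :=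
    measurePreserving_sub_right volume t
  have hme : MeasurableEmbedding (fun u : ℝ => u - t) := measurableEmbedding_subRight t
  have hint' : IntegrableOn (fun u : ℝ => ((u - t) ^ 2)⁻¹) {u : ℝ | δ ≤ |u - t|} :=
    (hmp.integrableOn_comp_preimage hme).2 hint
  have hval' : ∫ u in {u : ℝ | δ ≤ |u - t|}, ((u - t) ^ 2)⁻¹ = 2 * δ⁻¹ := by
    rw [← hval]
    exact hmp.setIntegral_preimage_emb hme (fun v : ℝ => (v ^ 2)⁻¹) {v : ℝ | δ ≤ |v|}
  refine ⟨hint'.const_mul _, ?_⟩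
  rw [integral_const_mul, hval']
  field_simp

/-- **Tools stub** (`stub_selfInductionTail`): the `e`-uniform tail bound for the self-induction
integral. For `c > 0`, `δ > 0`, a `C¹` curve `X : ℝ → ℝ³` with `‖X′‖ ≤ 1` which is chord-arc
from `t`, `c |u − t| ≤ ‖X u − X t‖`, the regularised Biot–Savart integrand
`u ↦ ((‖X t − X u‖² + e²)^{3/2})⁻¹ • X′(u) × (X t − X u)` is integrable on the tail
`{u | δ ≤ |u − t|}` and its integral there has norm at most `2 / (c² δ)`, uniformly in the core
parameter `e ≠ 0` (pointwise bound `c⁻² (u − t)⁻²`, whose tail integral is `2 / (c² δ)`).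
[folklore] -/
theorem stub_selfInductionTail :
    ∀ (e c δ : ℝ) (X : ℝ → EuclideanSpace ℝ (Fin 3)) (t : ℝ), e ≠ 0 → 0 < c → 0 < δ → ContDiff ℝ 1 X →
      (∀ u, ‖deriv X u‖ ≤ 1) → (∀ u, c * |u - t| ≤ ‖X u - X t‖) →
      IntegrableOn (fun u : ℝ => ((‖X t - X u‖ ^ 2 + e ^ 2) ^ (3 / 2 : ℝ))⁻¹ • cross (deriv X u) (X t - X u))
        {u : ℝ | δ ≤ |u - t|} ∧
      ‖∫ u in {u : ℝ | δ ≤ |u - t|}, ((‖X t - X u‖ ^ 2 + e ^ 2) ^ (3 / 2 : ℝ))⁻¹ • cross (deriv X u) (X t - X u)‖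
        ≤ 2 / (c ^ 2 * δ) := by
  intro e c δ X t he hc hδ hX hdX hchord
  have hSm : MeasurableSet {u : ℝ | δ ≤ |u - t|} :=
    (isClosed_le continuous_const (continuous_abs.comp (continuous_id.sub continuous_const))).measurableSet
  -- continuity of the integrand (uses `e ≠ 0`)
  have hXc : Continuous X := hX.continuous
  have hdc : Continuous (deriv X) := hX.continuous_deriv le_rfl
  have hb : ∀ u : ℝ, 0 < ‖X t - X u‖ ^ 2 + e ^ 2 := fun u => by positivity
  have hsc : Continuous fun u : ℝ => ((‖X t - X u‖ ^ 2 + e ^ 2) ^ (3 / 2 : ℝ))⁻¹ :=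
    ((((continuous_const.sub hXc).norm.pow 2).add continuous_const).rpow_const
      fun u => Or.inr (by norm_num)).inv₀ fun u => (Real.rpow_pos_of_pos (hb u) _).ne'
  have hcr : Continuous fun u : ℝ => cross (deriv X u) (X t - X u) :=
    (crossCLM.continuous.comp hdc).clm_apply (continuous_const.sub hXc)
  have hcont : Continuous fun u : ℝ =>
      ((‖X t - X u‖ ^ 2 + e ^ 2) ^ (3 / 2 : ℝ))⁻¹ • cross (deriv X u) (X t - X u) := hsc.smul hcr
  -- the majorant
  obtain ⟨hg_int, hg_val⟩ := sit_majorant_tail c t hδ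
  -- the pointwise bound on the tail
  have hbound : ∀ u ∈ {u : ℝ | δ ≤ |u - t|},
      ‖((‖X t - X u‖ ^ 2 + e ^ 2) ^ (3 / 2 : ℝ))⁻¹ • cross (deriv X u) (X t - X u)‖
        ≤ (c ^ 2)⁻¹ * ((u - t) ^ 2)⁻¹ := by
    intro u hu
    simp only [mem_setOf_eq] at hu
    have hut : 0 < |u - t| := lt_of_lt_of_le hδ hu
    have hcu : 0 < c * |u - t| := mul_pos hc hut
    have hr : c * |u - t| ≤ ‖X t - X u‖ := by
      rw [norm_sub_rev]
      exact hchord u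
    have hrpos : 0 < ‖X t - X u‖ := lt_of_lt_of_le hcu hr
    rw [norm_smul, norm_inv, Real.norm_of_nonneg (Real.rpow_nonneg (hb u).le _)]
    calc ((‖X t - X u‖ ^ 2 + e ^ 2) ^ (3 / 2 : ℝ))⁻¹ * ‖cross (deriv X u) (X t - X u)‖
        ≤ ((‖X t - X u‖ ^ 2 + e ^ 2) ^ (3 / 2 : ℝ))⁻¹ * ‖X t - X u‖ := by
          refine mul_le_mul_of_nonneg_left ?_ (inv_nonneg.2 (Real.rpow_nonneg (hb u).le _))
          calc ‖cross (deriv X u) (X t - X u)‖ ≤ ‖deriv X u‖ * ‖X t - X u‖ :=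
                sit_norm_cross_le _ _
            _ ≤ 1 * ‖X t - X u‖ := mul_le_mul_of_nonneg_right (hdX u) (norm_nonneg _)
            _ = ‖X t - X u‖ := one_mul _
      _ ≤ (‖X t - X u‖ ^ 2)⁻¹ := sit_kernel_mul_le_inv_sq hrpos e
      _ ≤ ((c * |u - t|) ^ 2)⁻¹ :=
          inv_anti₀ (pow_pos hcu 2) (pow_le_pow_left₀ hcu.le hr 2)
      _ = (c ^ 2)⁻¹ * ((u - t) ^ 2)⁻¹ := by
          rw [mul_pow, sq_abs, mul_inv]
  have hae : ∀ᵐ u ∂(volume.restrict {u : ℝ | δ ≤ |u - t|}),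
      ‖((‖X t - X u‖ ^ 2 + e ^ 2) ^ (3 / 2 : ℝ))⁻¹ • cross (deriv X u) (X t - X u)‖
        ≤ (c ^ 2)⁻¹ * ((u - t) ^ 2)⁻¹ :=
    (ae_restrict_iff' hSm).2 (Eventually.of_forall hbound)
  refine ⟨Integrable.mono' hg_int hcont.aestronglyMeasurable hae, ?_⟩
  calc ‖∫ u in {u : ℝ | δ ≤ |u - t|},
          ((‖X t - X u‖ ^ 2 + e ^ 2) ^ (3 / 2 : ℝ))⁻¹ • cross (deriv X u) (X t - X u)‖
      ≤ ∫ u in {u : ℝ | δ ≤ |u - t|}, (c ^ 2)⁻¹ * ((u - t) ^ 2)⁻¹ :=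
        norm_integral_le_of_norm_le hg_int hae
    _ = 2 / (c ^ 2 * δ) := hg_val

end Summit.NavierStokesRegularity.NavierStokesRegularity.Theorems.SkeletonEquilibrium.Sketch
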